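import Literature.Topology.FourManifolds.SimplifiedBrokenLefschetzFibration
import HarnessLib

/-!
# Named fact: the unit 4-sphere carries a genus-one simplified broken Lefschetz fibration
# without Lefschetz points

Topic `Literature/Topology/FourManifolds`.  ONE named fact (D-0014), stated over the tree's
`Literature.Topology.FourManifolds.IsSimplifiedBrokenLefschetzFibration o f L h` (simplified broken
Lefschetz fibration of lower genus `h` with positive Lefschetz set `L` and NON-EMPTY connected
round locus, `SimplifiedBrokenLefschetzFibration.lean`): the Auroux–Donaldson–Katzarkov genus-`1`
broken fibration `S⁴ → S²` — one indefinite fold circle with embedded image, regular fibres `T²`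
over one hemisphere and `S²` over the other, no Lefschetz critical point.

Sources.  D. Auroux, S. K. Donaldson, L. Katzarkov, *Singular Lefschetz pencils*, Geom. Topol. 9
(2005) 1043–1114 (arXiv:math/0410332), §8.2, Example 1: *"The simplest non-trivial examples of
singular Lefschetz fibrations `f : X → S²` are those where `Γ` is connected, with a neighbourhood
modelled on `N_+`, there are no isolated singular fibres, and the fibres are connected of genus `0`
over `D_+` and genus `1` over `D_-`"* […] *"if eg, we twist the fibration by a loop of
diffeomorphisms of `T²` corresponding to a unit translation in the direction transverse to the
vanishing cycle, we lose the existence of a section, and the total space becomes simply connected.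
In fact, the new total space `X'` is diffeomorphic to `S⁴`."*  R. İ. Baykur, S. Kamada,
*Classification of broken Lefschetz fibrations with small fiber genera*, J. Math. Soc. Japan 67
(2015) (arXiv:1010.5814), §5: *"One round singular circle, no Lefschetz singularity. Three
possibilities for the total spaces in this case are `S² × S² # S¹ × S³`, `CP² # CP²bar # S¹ × S³`,
or `S⁴`, as explored in [ADK] […]. We will refer to these as "standard" broken fibrations on the
corresponding 4-manifolds."*, Lemma 11 and Remark 12 (*"the standard one on `S⁴`"*).  K. Hayano,
*On genus-1 simplified broken Lefschetz fibrations*, Algebr. Geom. Topol. 11 (2011)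
(arXiv:1012.4049), Main Theorem A (`#k S² × S²`, `k ≥ 0`), Thm. 4.2 with its proof
(`M_{1,l} = # r CP²bar`, `r = 0`) and Rem. 4.3 (these are the examples of ADK §8.2 Ex. 1).
R. İ. Baykur, *Broken Lefschetz fibrations and smooth structures on 4-manifolds*, Geom. Topol.
Monogr. 18 (2012) (arXiv:1205.5439), Thm. 18 and its proof (*"We immediately see that the broken
genera of `S⁴`, `CP²bar` […] are one"*), Rem. 14 (*"the genus one SBLFs on `S⁴` and `CP²bar`"*).

* `exists_sblf_genus_one_noLefschetz_sphere_four` — the named fact: Mathlib's unit sphere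
  `Metric.sphere (0 : EuclideanSpace ℝ (Fin 5)) 1` (stereographic charts on `ℝ⁴`) carries a smooth
  orientation `o` and a map `f` to the unit `2`-sphere with
  `IsSimplifiedBrokenLefschetzFibration o f ∅ 0`.

## Design choices

* **The existential shape** `∃ o f, IsSimplifiedBrokenLefschetzFibration o f ∅ 0` is the one the
  `SmoothPoincare4` route `SblfDescent` consumes (`HAS(S⁴, 0)` with `L = ∅`); the Lefschetz set is
  pinned to `∅` as in the sources (and as forced by Baykur 2012, Lemma 7, `e(S⁴) = 2 = 6 - 4 + k`,
  the tree's `card_eq_four_mul_of_sblf_of_homotopyEquiv_sphere_four`).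
* **The model of `S⁴`** is Mathlib's round unit sphere in `ℝ⁵` with its stereographic `C^ω`
  structure, the model used by every `S⁴`-fact of this directory
  (`nonempty_diffeomorph_sphere_four_of_sblf_genus_one_noLefschetz`, `HomotopyS4Compact.lean`, …);
  it is the standard smooth `S⁴` of the sources.
* Every field of `IsSimplifiedBrokenLefschetzFibration o f ∅ 0` is a consequence of the printed
  construction (see the docstring), so the reading is a faithful weakening; nothing is asserted.
* **Relation to `sblf_of_every_genus_of_diffeomorph_sphere_four`** (Baykur 2012, Thm. 18 with
  Lemma 12, in `SimplifiedBrokenLefschetzExistence.lean`: every manifold diffeomorphic to `S⁴`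
  carries SBLFs of EVERY lower genus `h`, Lefschetz set unspecified).  The present fact is the
  printed base case of that induction (Baykur: *"We immediately see that the broken genera of
  `S⁴` […] are one"*, from ADK's example), with the weaker content a consumer of the genus-one
  rung actually needs; conversely the every-genus fact at `h = 0` together with the Euler count
  `card_eq_four_mul_of_sblf_of_homotopyEquiv_sphere_four` (`L.card = 4 · 0`) recovers it, a
  reduction for the `…Proofs` sibling.

Deliberately NOT here: the other Lefschetz-free genus-`1` total spaces (`S² × S² # S¹ × S³`,
`CP² # CP²bar # S¹ × S³`, Pao's `L_n`, `L'_n` — not yet objects of the tree), SBLFs of higher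
genus on `S⁴` (Baykur 2012, Lemma 12: flip-and-slip; see
`sblf_of_every_genus_of_diffeomorph_sphere_four`), uniqueness up to isomorphism of the fibration,
and any near-symplectic structure (there is none: `b⁺(S⁴) = 0`, Baykur–Kamada Rem. 15).

## References

* D. Auroux, S. K. Donaldson, L. Katzarkov, *Singular Lefschetz pencils*, Geom. Topol. 9 (2005)
  1043–1114, §1 (indefinite quadratic singularities), §8.1, §8.2 Example 1.
  [AurouxDonaldsonKatzarkov2005]
* R. İ. Baykur, S. Kamada, *Classification of broken Lefschetz fibrations with small fiber
  genera*, J. Math. Soc. Japan 67 (2015) 877–901, §3, §5, Lemma 11, Rem. 12. [BaykurKamada2015]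
* K. Hayano, *On genus-1 simplified broken Lefschetz fibrations*, Algebr. Geom. Topol. 11 (2011)
  1267–1322, Main Theorem A, Thm. 4.2, Rem. 4.3. [Hayano2011]
* R. İ. Baykur, *Broken Lefschetz fibrations and smooth structures on 4-manifolds*, Geom. Topol.
  Monogr. 18 (2012) 9–34, Thm. 18, Rem. 14. [Baykur2012]
-/

namespace Literature.Topology.FourManifolds

open scoped Manifold ContDiff Topology

/-- NAMED FACT — **the unit 4-sphere carries a genus-one simplified broken Lefschetz fibration
with non-empty round locus and no Lefschetz point** (Auroux–Donaldson–Katzarkov 2005, §8.2,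
Example 1, verbatim: *"The simplest non-trivial examples of singular Lefschetz fibrations
`f : X → S²` are those where `Γ` is connected, with a neighbourhood modelled on `N_+`, there are no
isolated singular fibres, and the fibres are connected of genus `0` over `D_+` and genus `1` over
`D_-` […]. The total space of the fibration is a smooth 4–manifold `X` obtained by gluing together
the three open pieces `X_- ≃ T² × D²` lying over the southern hemisphere `D_-`, `W` lying over a
neighbourhood of the equator, and `X_+ ≃ S² × D²` lying over the northern hemisphere `D_+`"* […]
*"if eg, we twist the fibration by a loop of diffeomorphisms of `T²` corresponding to a unit
translation in the direction transverse to the vanishing cycle, we lose the existence of a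
section, and the total space becomes simply connected. In fact, the new total space `X'` is
diffeomorphic to `S⁴`. Indeed, `X_- ∪ W` is still the complement of a closed loop in `S¹ × S³`,
but the missing loop `γ'` now projects non-trivially to the `S¹` factor, and is isotopic to
`S¹ × {pt} ⊂ S¹ × S³`. Therefore, we now have `X_- ∪ W ≃ S¹ × B³`, and by gluing `X_+ = D² × S²`
along the boundary we obtain `X' ≃ S⁴`."*; there, §1, `f` *"has indefinite quadratic
singularities along `Δ`"* means the local model `(y₀, y₁, y₂, t) ↦ y₀² - ½(y₁² + y₂²) + i t` with
`Δ = {y = 0}`.  Baykur–Kamada 2015, §5, verbatim: *"One round singular circle, no Lefschetz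
singularity. Three possibilities for the total spaces in this case are `S² × S² # S¹ × S³`,
`CP² # CP²bar # S¹ × S³`, or `S⁴`, as explored in [ADK] and depicted by the Kirby diagrams in
Figure […]. We will refer to these as "standard" broken fibrations on the corresponding
4-manifolds."*, whence Lemma 11: *"The only closed oriented 4-manifolds admitting a genus one
broken Lefschetz fibration with no Lefschetz singularities are `S⁴`, `S² × S² # S¹ × S³`,
`CP² # CP²bar # S¹ × S³`, `L_n`, and `L'_n`"* and Rem. 12: *"One can alternatively produce all
these SBLFs from the standard one on `S⁴` […]"*.  Equally Hayano 2011, Main Theorem A: *"The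
following 4-manifolds admit genus-1 simplified broken Lefschetz fibration structures with
non-empty round singular locus. […] `#k S² × S²`, where `k ≥ 0`"* (`k = 0`), with the proof of
Thm. 4.2 (Hurwitz system `W_f = S_r`, total space `M_{1,l} = # r CP²bar`; `r = 0`: no Lefschetz
singularity, total space `S⁴`) and Rem. 4.3 (these are the fibrations of ADK §8.2 Ex. 1); Baykur
2012, proof of Thm. 18: *"We immediately see that the broken genera of `S⁴`, `CP²bar` […] are
one"*.)  LEAN READING, in the tree's vocabulary (`IsSimplifiedBrokenLefschetzFibration o f L h`:
`f` smooth and onto, positive Lefschetz points exactly at the finite set `L`, indefinite fold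
charts `(t, x₁, x₂, x₃) ↦ (t, x₁² + x₂² - x₃²)` at the other critical points, round locus
non-empty and connected, `f` injective on the critical set, regular fibres connected of genus
`h + 1` or `h` read as `H₁ ≅ ℤ^{2(h+1)}` or `ℤ^{2h}`, both occurring, Lefschetz values on the
higher side): there are a smooth orientation `o` of the unit sphere `S⁴ ⊆ ℝ⁵` (Mathlib's
`Metric.sphere (0 : EuclideanSpace ℝ (Fin 5)) 1` with its stereographic `C^ω` structure charted on
`EuclideanSpace ℝ (Fin 4)`) and a map `f : S⁴ → S²` to the unit `2`-sphere with
`IsSimplifiedBrokenLefschetzFibration o f ∅ 0` — genus `1`, lower genus `0`, round locus non-empty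
and connected, EMPTY Lefschetz set.  Every clause is a consequence of the printed construction:
the two Lefschetz clauses are vacuous for `L = ∅`; the critical set is the single fold circle
`Γ`, on which `f` is injective (embedded round image, the equator), and ADK's model
`y₀² - ½(y₁² + y₂²) + i t` is the tree's `(t, x₁² + x₂² - x₃²)` after permuting and rescaling the
source coordinates and reflecting the second target coordinate; the regular fibres are tori
(`H₁ ≅ ℤ²`, genus `0 + 1`) over `D_-` and spheres (`H₁ = 0`, genus `0`) over `D_+`.  So this is a
faithful weakening.  Compared with `sblf_of_every_genus_of_diffeomorph_sphere_four` (Baykur 2012,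
Thm. 18 and Lemma 12: SBLFs of every lower genus `h` on every manifold diffeomorphic to `S⁴`) this
is the printed base case `h = 0` on the sphere itself with the Lefschetz set pinned to `∅`; the
every-genus fact at `h = 0` plus the Euler count
`card_eq_four_mul_of_sblf_of_homotopyEquiv_sphere_four` recovers it.  Users take
`(h : exists_sblf_genus_one_noLefschetz_sphere_four)`; nothing is asserted.
[cite: AurouxDonaldsonKatzarkov2005, §8.2 Example 1] -/
def exists_sblf_genus_one_noLefschetz_sphere_four : Prop :=
  ∃ (o : SmoothOrientation (𝓡 4) (Metric.sphere (0 : EuclideanSpace ℝ (Fin 5)) 1))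
    (f : Metric.sphere (0 : EuclideanSpace ℝ (Fin 5)) 1 →
      Metric.sphere (0 : EuclideanSpace ℝ (Fin 3)) 1),
    IsSimplifiedBrokenLefschetzFibration o f ∅ 0

end Literature.Topology.FourManifolds
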